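import Mathlib
import HarnessLib
import Literature.Analysis.FluidPDE.TaoEnstrophyLocalisationProofs
import Literature.Analysis.FluidPDE.PressureNormalisationL3
import Summits.NavierStokesRegularity.NavierStokesRegularity.Theorems.QuarterLogPincerTypeIQuantSubcubicExpUnitScaleTools

/-!
# Crux `QuarterLogPincer.TypeIQuantSubcubicExp` (stmt-NavierStokesRegularity-24077), line `thin_cascade`:
  clauses `A` and `E` of `UniformScaledEnergy` at UNIT SCALE for a Tao frame under the Type-I rate

Helper file (`--supports stmt-NavierStokesRegularity-24077 --as helper`, lead prover ns-tc-p1 g3) toward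
the registered 4th stub `stub_uniformScaledEnergy : UniformScaledEnergy` (skeleton v5).  For a classical
solution `(u, p)` on `[0,T]` (`ν = 1`, zero force) with slices uniformly in `L²` (the part of `TaoFrame` that
is used; both hypotheses are scale covariant), with the virtual Type-I bound `‖u(t,x)‖ ≤ M (T+τ−t)^{-1/2}` (`τ > 0`) and `T ≥ 1`, this file proves, with a function
`B(M)` of the Type-I constant ALONE,

* `A`: `∫_{B(x,1)} ‖u(t)‖² ≤ B(M)` for every centre `x` and every `t ∈ [T−1, T]`;
* `E`: `∫_{[T−1,T]} ∫_{B(x,1)} ‖∇u‖² ≤ B(M)` for every centre `x`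

(`exists_unitScale_energy_bounds`).  Ingredients (`…UnitScaleTools`): the Type-I weight, the uniform
`L²` bound of the frame, Tao's pressure normalisation on `(0,T)`; then the weighted `L²_uloc` Gronwall
bound `exists_uloc_gronwall` (`…Gronwall`) on closed windows inside `(0,T)` (`exists_window_bound`), the
endpoint `t = T−1` by the rate and `t = T` by Fatou, and clause `E` by exhausting `(T−1, T)` with closed
windows (`lintegral_window_grad_le`, operator norm `≤` Frobenius norm).  Clause `D` and the rescaling to a
general radius are NOT here.

HONEST FRAMING: one registered stub of an open crux is being assembled; nothing about Navier–Stokes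
regularity is proved; no summit statement is proved by this file.
-/

noncomputable section

-- the summit-side namespace `Summit.NavierStokesRegularity.NavierStokesRegularity.…` (single-conjunct summit,
-- D-0017) repeats a component by design; the dupNamespace linter would flag every declaration.
set_option linter.dupNamespace false

namespace Summit.NavierStokesRegularity.NavierStokesRegularity.Theorems.ThinCascade

open MeasureTheory Set Function Metric Filter Topology
open scoped ENNReal NNReal ContDiff
open Literature.Analysis Literature.Analysis.FluidPDE Literature.Analysis.FluidPDE.JiaSverak2013
open Summit.NavierStokesRegularity.NavierStokesRegularity.Cruxes.TypeIQuantSubcubicExp.ThinCascade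
  (TaoFrame)

/-! ### Pressure normalisation for a classical solution with uniformly `L²` slices -/

/-- **Tao's pressure normalisation under a pointwise bound**, for a classical solution on `[0,T]` whose
slices are uniformly in `L²` (the two clauses of `TaoFrame` that are used): on `(0, T)`,
`p(t) = Π[u(t)] + C(t)` a.e. (`PressureNormalisationL3.pressure_ae_eq_rieszPressure_add_const`; the
slices are in `L³` with a uniform bound). [cite: Tao2011, Lemma 4.1 (i)] -/
theorem pressure_normalised_of_classical {T m : ℝ}
    {u : ℝ → EuclideanSpace ℝ (Fin 3) → EuclideanSpace ℝ (Fin 3)} {p : ℝ → EuclideanSpace ℝ (Fin 3) → ℝ}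
    (hcl0 : IsClassicalNSSolutionOn (Icc 0 T) 1 0 u p)
    (hEx : ∃ E₀ : ℝ≥0∞, E₀ ≠ ⊤ ∧ ∀ t ∈ Icc 0 T, ∫⁻ x, ‖u t x‖ₑ ^ 2 ≤ E₀)
    (hum : ∀ t ∈ Icc 0 T, ∀ x, ‖u t x‖ ≤ m) :
    ∀ t ∈ Ioo 0 T, ∃ C : ℝ, ∀ᵐ x ∂(volume : Measure (EuclideanSpace ℝ (Fin 3))),
      p t x = rieszPressure (u t) x + C := by
  obtain ⟨E₀, hE₀, hE⟩ := hEx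
  have hcl : IsClassicalNSSolutionOn (Ioo 0 T) 1 0 u p :=
    hcl0.mono Ioo_subset_Icc_self (uniqueDiffOn_Ioo 0 T)
  have h2 : ∀ t ∈ Ioo 0 T, MemLp (u t) 2 volume := fun t ht =>
    memLp_two_of_lintegral_ne_top (hcl.contDiff_velocity ht).continuous
      (ne_top_of_le_ne_top hE₀ (hE t (Ioo_subset_Icc_self ht)))
  have h3 : ∀ t ∈ Ioo 0 T, MemLp (u t) 3 volume := fun t ht =>
    memLp_three_of_memLp_two_of_norm_le (h2 t ht) (hum t (Ioo_subset_Icc_self ht))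
  set M₃ : ℝ≥0 := ((ENNReal.ofReal m * E₀) ^ (1 / 3 : ℝ)).toNNReal with hM₃
  have hM₃top : (ENNReal.ofReal m * E₀) ^ (1 / 3 : ℝ) ≠ ⊤ :=
    ENNReal.rpow_ne_top_of_nonneg (by norm_num) (ENNReal.mul_ne_top ENNReal.ofReal_ne_top hE₀)
  have hM₃coe : (M₃ : ℝ≥0∞) = (ENNReal.ofReal m * E₀) ^ (1 / 3 : ℝ) := ENNReal.coe_toNNReal hM₃top
  have hM : ∀ t ∈ Ioo 0 T, eLpNorm (u t) 3 volume ≤ M₃ := by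
    intro t ht
    rw [hM₃coe, eLpNorm_eq_lintegral_rpow_enorm_toReal (by norm_num) (by norm_num), ENNReal.toReal_ofNat]
    refine ENNReal.rpow_le_rpow ?_ (by norm_num)
    have hcube : ∫⁻ x, ‖u t x‖ₑ ^ (3 : ℝ) = ∫⁻ x in univ, ‖u t x‖ₑ ^ (3 : ℕ) := by
      rw [Measure.restrict_univ]
      exact lintegral_congr fun x => by
        rw [show (3 : ℝ) = ((3 : ℕ) : ℝ) by norm_num, ENNReal.rpow_natCast]
    rw [hcube]
    calc ∫⁻ x in univ, ‖u t x‖ₑ ^ (3 : ℕ)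
        ≤ ENNReal.ofReal m * ∫⁻ x in univ, ‖u t x‖ₑ ^ 2 :=
          lintegral_cube_le_mul_sq (hum t (Ioo_subset_Icc_self ht)) univ
      _ ≤ ENNReal.ofReal m * E₀ := by
          rw [Measure.restrict_univ]
          exact mul_le_mul' le_rfl (hE t (Ioo_subset_Icc_self ht))
  intro t ht
  exact PressureNormalisationL3.pressure_ae_eq_rieszPressure_add_const zero_le_one hcl h3 hM ht

/-! ### Windows inside `(0, T)`: the Gronwall bound with a constant depending on `M` only -/

/-- **The window bound.** There is `B : ℝ → ℝ`, `B ≥ 0`, such that for every classical solution on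
`[0,T]` with uniformly `L²` slices and the Type-I rate (constant `M`, `τ > 0`) and every closed window `[t₀, t₁] ⊆ (0, T)` with `T − 1 ≤ t₀ ≤ T − 1/2`:
every unit-ball energy on the window and every cut-off dissipation over the window is `≤ B(M)`
(`exists_uloc_gronwall` with `m(t₀)² ≤ 2M²` and `∫_{t₀}^{t₁} (a₁ + a₂ m) ≤ a₁ + 2 a₂ |M|`). [folklore] -/
theorem exists_window_bound :
    ∃ B : ℝ → ℝ, (∀ M, 0 ≤ B M) ∧
      ∀ {M T τ : ℝ} {u : ℝ → EuclideanSpace ℝ (Fin 3) → EuclideanSpace ℝ (Fin 3)}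
        {p : ℝ → EuclideanSpace ℝ (Fin 3) → ℝ}, IsClassicalNSSolutionOn (Icc 0 T) 1 0 u p →
        (∃ E₀ : ℝ≥0∞, E₀ ≠ ⊤ ∧ ∀ t ∈ Icc 0 T, ∫⁻ x, ‖u t x‖ₑ ^ 2 ≤ E₀) → 0 < τ →
        (∀ t ∈ Icc 0 T, ∀ x, ‖u t x‖ ≤ M * (T + τ - t) ^ (-(1 / 2 : ℝ))) →
        ∀ {t₀ t₁ : ℝ}, 0 < t₀ → T - 1 ≤ t₀ → t₀ ≤ T - 1 / 2 → t₀ ≤ t₁ → t₁ < T →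
        ∀ (y : EuclideanSpace ℝ (Fin 3)),
          (∀ t ∈ Icc t₀ t₁, ∫⁻ x in ball y 1, ‖u t x‖ₑ ^ 2 ≤ ENNReal.ofReal (B M)) ∧
          (∫ s in t₀..t₁, ∫ x, frobeniusNormSq (fderiv ℝ (u s) x) * radialCutoff 2 3 (y - x) ≤ B M) := by
  obtain ⟨a₀, a₁, a₂, ha₀, ha₁, ha₂, hG⟩ := exists_uloc_gronwall
  refine ⟨fun M => a₀ * (2 * M ^ 2) * Real.exp (a₁ + a₂ * (2 * |M|)), fun M => by positivity, ?_⟩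
  intro M T τ u p hcl0 hEx hτ hrate t₀ t₁ ht₀0 hT1 hThalf ht₀₁ ht₁T y
  -- the data of `exists_uloc_gronwall`
  have hS : IsOpen (Ioo (0 : ℝ) T) := isOpen_Ioo
  have hcl : IsClassicalNSSolutionOn (Ioo 0 T) 1 0 u p :=
    hcl0.mono Ioo_subset_Icc_self (uniqueDiffOn_Ioo 0 T)
  have hI : Icc t₀ t₁ ⊆ Ioo 0 T := fun t ht => ⟨lt_of_lt_of_le ht₀0 ht.1, lt_of_le_of_lt ht.2 ht₁T⟩
  have hIcc : Icc t₀ t₁ ⊆ Icc 0 T := fun t ht => Ioo_subset_Icc_self (hI ht)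
  obtain ⟨E₀, hE₀, hE⟩ := id hEx
  set m : ℝ → ℝ := fun s => |M| * (max (T + τ - s) τ) ^ (-(1 / 2 : ℝ)) with hm
  have hmc : Continuous m := continuous_typeIWeight M T hτ
  have hm0 : ∀ s, 0 ≤ m s := typeIWeight_nonneg M T hτ
  have humT : ∀ t ∈ Icc 0 T, ∀ x, ‖u t x‖ ≤ m t := fun t ht x =>
    norm_le_typeIWeight hτ ht.2 (hrate t ht x)
  have hum : ∀ t ∈ Icc t₀ t₁, ∀ x, ‖u t x‖ ≤ m t := fun t ht x => humT t (hIcc ht) x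
  have hmbar : ∀ t ∈ Icc 0 T, ∀ x, ‖u t x‖ ≤ |M| * τ ^ (-(1 / 2 : ℝ)) := fun t ht x =>
    (humT t ht x).trans (typeIWeight_le M T hτ t)
  have hp := pressure_normalised_of_classical hcl0 hEx hmbar
  have hp' : ∀ t ∈ Icc t₀ t₁, ∃ C : ℝ, ∀ᵐ x ∂(volume : Measure (EuclideanSpace ℝ (Fin 3))),
      p t x = rieszPressure (u t) x + C := fun t ht => hp t (hI ht)
  have key := fun t (ht : t ∈ Icc t₀ t₁) =>
    hG hS hcl ht₀₁ hI hE₀ (fun s hs => hE s (hIcc hs)) hmc hm0 hum hp' y t ht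
  -- the constant
  have hB : a₀ * m t₀ ^ 2 * Real.exp (∫ s in t₀..t₁, (a₁ + a₂ * m s)) ≤
      a₀ * (2 * M ^ 2) * Real.exp (a₁ + a₂ * (2 * |M|)) := by
    have h1 : m t₀ ^ 2 ≤ 2 * M ^ 2 := typeIWeight_sq_le hτ hThalf
    have h2 : ∫ s in t₀..t₁, (a₁ + a₂ * m s) ≤ a₁ + a₂ * (2 * |M|) := by
      rw [intervalIntegral.integral_add intervalIntegrable_const ((hmc.const_mul a₂).intervalIntegrable _ _),
        intervalIntegral.integral_const, intervalIntegral.integral_const_mul, smul_eq_mul]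
      have hlen : (t₁ - t₀) * a₁ ≤ a₁ := by nlinarith
      have hint : ∫ s in t₀..t₁, m s ≤ 2 * |M| := integral_typeIWeight_le hτ hT1 ht₀₁ ht₁T.le
      nlinarith
    gcongr
  constructor
  · intro t ht
    exact (key t ht).1.trans (ENNReal.ofReal_le_ofReal hB)
  · exact (key t₁ (right_mem_Icc.2 ht₀₁)).2.trans hB

/-! ### Clause `E` on a closed window: from the cut-off dissipation to the unit ball -/

/-- On a closed window `[t₀, t₁] ⊆ (0,T)`: `∫_{[t₀,t₁]} ∫_{B(y,1)} ‖∇u‖² ≤ ∫_{t₀}^{t₁} ∫ |∇u|²_F φ_y`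
(operator norm `≤` Frobenius norm; `φ_y = 1` on `B(y,1)`, `φ_y ≥ 0`; Tonelli in time for the continuous
dissipation). [folklore] -/
theorem lintegral_window_grad_le {T : ℝ}
    {u : ℝ → EuclideanSpace ℝ (Fin 3) → EuclideanSpace ℝ (Fin 3)} {p : ℝ → EuclideanSpace ℝ (Fin 3) → ℝ}
    (hcl : IsClassicalNSSolutionOn (Ioo 0 T) 1 0 u p) {t₀ t₁ : ℝ} (ht₀₁ : t₀ ≤ t₁)
    (hI : Icc t₀ t₁ ⊆ Ioo 0 T) (y : EuclideanSpace ℝ (Fin 3)) :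
    ∫⁻ t in Icc t₀ t₁, ∫⁻ x in ball y 1, ENNReal.ofReal (‖fderiv ℝ (u t) x‖ ^ 2) ≤
      ENNReal.ofReal (∫ s in t₀..t₁, ∫ x, frobeniusNormSq (fderiv ℝ (u s) x) * radialCutoff 2 3 (y - x)) := by
  set D : ℝ → ℝ := fun s => ∫ x, frobeniusNormSq (fderiv ℝ (u s) x) * radialCutoff 2 3 (y - x) with hD
  have hD0 : ∀ s, 0 ≤ D s := fun s => integral_nonneg fun x =>
    mul_nonneg (frobeniusNormSq_nonneg _) (testFn_nonneg y x)
  have hDc : ContinuousOn D (Icc t₀ t₁) :=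
    (hcl.continuousOn_integral_dissipation_cutoff isOpen_Ioo (contDiff_cutoff_infty y).continuous
      (hasCompactSupport_cutoff y)).mono hI
  have hDi : IntegrableOn D (Icc t₀ t₁) volume := hDc.integrableOn_compact isCompact_Icc
  -- the slice bound
  have hslice : ∀ s ∈ Icc t₀ t₁, ∫⁻ x in ball y 1, ENNReal.ofReal (‖fderiv ℝ (u s) x‖ ^ 2) ≤
      ENNReal.ofReal (D s) := by
    intro s hs
    have hu1 : ContDiff ℝ 1 (u s) := (hcl.contDiff_velocity (hI hs)).of_le (by norm_cast)
    have hcont : Continuous fun x => frobeniusNormSq (fderiv ℝ (u s) x) * radialCutoff 2 3 (y - x) :=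
      (LerayHopfProofs.continuous_frobeniusNormSq.comp (hu1.continuous_fderiv one_ne_zero)).mul
        (contDiff_cutoff_infty y).continuous
    have hint : Integrable (fun x => frobeniusNormSq (fderiv ℝ (u s) x) * radialCutoff 2 3 (y - x)) :=
      hcont.integrable_of_hasCompactSupport (hasCompactSupport_cutoff y).mul_left
    rw [hD]
    dsimp only
    rw [ofReal_integral_eq_lintegral_ofReal hint (ae_of_all _ fun x =>
      mul_nonneg (frobeniusNormSq_nonneg _) (testFn_nonneg y x))]
    calc ∫⁻ x in ball y 1, ENNReal.ofReal (‖fderiv ℝ (u s) x‖ ^ 2)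
        ≤ ∫⁻ x in ball y 1, ENNReal.ofReal (frobeniusNormSq (fderiv ℝ (u s) x) *
            radialCutoff 2 3 (y - x)) := by
          refine setLIntegral_mono' measurableSet_ball fun x hx => ?_
          rw [testFn_eq_one (ball_subset_closedBall_two (by simp) hx), mul_one]
          exact ENNReal.ofReal_le_ofReal (sq_opNorm_le_frobeniusNormSq _)
      _ ≤ ∫⁻ x, ENNReal.ofReal (frobeniusNormSq (fderiv ℝ (u s) x) * radialCutoff 2 3 (y - x)) :=
          setLIntegral_le_lintegral _ _
  -- integrate in time
  calc ∫⁻ t in Icc t₀ t₁, ∫⁻ x in ball y 1, ENNReal.ofReal (‖fderiv ℝ (u t) x‖ ^ 2)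
      ≤ ∫⁻ t in Icc t₀ t₁, ENNReal.ofReal (D t) :=
        lintegral_mono_ae ((ae_restrict_mem measurableSet_Icc).mono hslice)
    _ = ENNReal.ofReal (∫ t in Icc t₀ t₁, D t) :=
        (ofReal_integral_eq_lintegral_ofReal hDi (ae_of_all _ hD0)).symm
    _ = ENNReal.ofReal (∫ s in t₀..t₁, D s) := by
        rw [intervalIntegral.integral_of_le ht₀₁, integral_Icc_eq_integral_Ioc]

/-! ### Clauses `A` and `E` at unit scale -/

/-- **Clauses `A` and `E` of `UniformScaledEnergy` at unit scale.**  There is `B : ℝ → ℝ`, `B ≥ 0`,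
such that for every classical solution `(u, p)` on `[0,T]` with uniformly `L²` slices, the Type-I rate
`‖u(t,x)‖ ≤ M (T+τ−t)^{-1/2}` (`τ > 0`) and `T ≥ 1`, and every centre `x`:
`∫_{B(x,1)} ‖u(t)‖² ≤ B(M)` for all `t ∈ [T−1, T]`, and `∫_{[T−1,T]} ∫_{B(x,1)} ‖∇u(t)‖² dt ≤ B(M)`.
Interior times by the window bound; `t = T−1` by the rate (`‖u‖ ≤ |M|` there); `t = T` by Fatou along
`tₙ ↑ T`; clause `E` by exhausting `(T−1,T)` with the windows `[T−1+δₙ, T−δₙ]`. [folklore] -/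
theorem exists_unitScale_energy_bounds :
    ∃ B : ℝ → ℝ, (∀ M, 0 ≤ B M) ∧
      ∀ {M T τ : ℝ} {u : ℝ → EuclideanSpace ℝ (Fin 3) → EuclideanSpace ℝ (Fin 3)}
        {p : ℝ → EuclideanSpace ℝ (Fin 3) → ℝ}, IsClassicalNSSolutionOn (Icc 0 T) 1 0 u p →
        (∃ E₀ : ℝ≥0∞, E₀ ≠ ⊤ ∧ ∀ t ∈ Icc 0 T, ∫⁻ x, ‖u t x‖ₑ ^ 2 ≤ E₀) → 0 < τ →
        (∀ t ∈ Icc 0 T, ∀ x, ‖u t x‖ ≤ M * (T + τ - t) ^ (-(1 / 2 : ℝ))) → 1 ≤ T →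
        ∀ x : EuclideanSpace ℝ (Fin 3),
          (∀ t ∈ Icc (T - 1) T, ∫⁻ y in ball x 1, ‖u t y‖ₑ ^ 2 ≤ ENNReal.ofReal (B M)) ∧
          (∫⁻ t in Icc (T - 1) T, ∫⁻ y in ball x 1, ENNReal.ofReal (‖fderiv ℝ (u t) y‖ ^ 2) ≤
            ENNReal.ofReal (B M)) := by
  obtain ⟨B, hB0, hW⟩ := exists_window_bound
  -- enlarge `B` to cover the endpoint `t = T - 1` (`M² |B₁| ≤ M² |B₃|`-type bound): use `B M + M² V₁`
  set V₁ : ℝ := (volume (ball (0 : EuclideanSpace ℝ (Fin 3)) 1)).toReal with hV₁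
  refine ⟨fun M => B M + M ^ 2 * V₁, fun M => add_nonneg (hB0 M) (mul_nonneg (sq_nonneg M)
    ENNReal.toReal_nonneg), ?_⟩
  intro M T τ u p hcl0 hEx hτ hrate hT x
  have hcl : IsClassicalNSSolutionOn (Ioo 0 T) 1 0 u p :=
    hcl0.mono Ioo_subset_Icc_self (uniqueDiffOn_Ioo 0 T)
  have hBle : ENNReal.ofReal (B M) ≤ ENNReal.ofReal (B M + M ^ 2 * V₁) :=
    ENNReal.ofReal_le_ofReal (by nlinarith [sq_nonneg M, ENNReal.toReal_nonneg (a := volume (ball (0 : EuclideanSpace ℝ (Fin 3)) 1))])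
  -- interior times: the window `[min t (T - 1/2), t]`
  have hinterior : ∀ t ∈ Ioo (T - 1) T, ∀ z : EuclideanSpace ℝ (Fin 3),
      ∫⁻ y in ball z 1, ‖u t y‖ₑ ^ 2 ≤ ENNReal.ofReal (B M) := by
    intro t ht z
    set t₀ : ℝ := min t (T - 1 / 2) with ht₀
    have h1 : 0 < t₀ := lt_min (by linarith [ht.1]) (by linarith)
    have h2 : T - 1 ≤ t₀ := le_min ht.1.le (by linarith)
    have h3 : t₀ ≤ T - 1 / 2 := min_le_right _ _
    have h4 : t₀ ≤ t := min_le_left _ _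
    exact (hW hcl0 hEx hτ hrate h1 h2 h3 h4 ht.2 z).1 t ⟨h4, le_rfl⟩
  constructor
  · -- ### clause A
    intro t ht
    rcases eq_or_lt_of_le ht.1 with h | h
    · -- `t = T - 1`: the rate gives `‖u‖ ≤ |M|`
      have hrt : ∀ y, ‖u t y‖ ≤ |M| := by
        intro y
        have := hrate t ⟨by linarith, ht.2⟩ y
        rw [← h] at this ⊢
        refine this.trans ?_
        have hb : (T + τ - (T - 1)) ^ (-(1 / 2 : ℝ)) ≤ 1 := by
          rw [show T + τ - (T - 1) = 1 + τ by ring]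
          exact Real.rpow_le_one_of_one_le_of_nonpos (by linarith) (by norm_num)
        calc M * (T + τ - (T - 1)) ^ (-(1 / 2 : ℝ)) ≤ |M| * (T + τ - (T - 1)) ^ (-(1 / 2 : ℝ)) :=
            mul_le_mul_of_nonneg_right (le_abs_self M) (Real.rpow_nonneg (by linarith) _)
          _ ≤ |M| * 1 := mul_le_mul_of_nonneg_left hb (abs_nonneg M)
          _ = |M| := mul_one _
      calc ∫⁻ y in ball x 1, ‖u t y‖ₑ ^ 2 ≤ ∫⁻ _ in ball x 1, ENNReal.ofReal (M ^ 2) := by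
            refine lintegral_mono fun y => ?_
            rw [← ofReal_norm, ← ENNReal.ofReal_pow (norm_nonneg _), ← sq_abs M]
            exact ENNReal.ofReal_le_ofReal (pow_le_pow_left₀ (norm_nonneg _) (hrt y) 2)
        _ = ENNReal.ofReal (M ^ 2 * V₁) := by
            rw [lintegral_const, Measure.restrict_apply_univ, Measure.addHaar_ball_center, hV₁,
              ENNReal.ofReal_mul (sq_nonneg M), ENNReal.ofReal_toReal measure_ball_lt_top.ne]
        _ ≤ ENNReal.ofReal (B M + M ^ 2 * V₁) := ENNReal.ofReal_le_ofReal (by linarith [hB0 M])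
    rcases eq_or_lt_of_le ht.2 with h' | h'
    · -- `t = T`: Fatou along `tₙ = T - 1/(n+2)`
      set tn : ℕ → ℝ := fun n => T - 1 / ((n : ℝ) + 2) with htn
      have htn_mem : ∀ n, tn n ∈ Ioo (T - 1) T := fun n => by
        have h2 : (0 : ℝ) < (n : ℝ) + 2 := by positivity
        have h3 : 1 / ((n : ℝ) + 2) < 1 := by rw [div_lt_one h2]; linarith [n.cast_nonneg (α := ℝ)]
        have h4 : 0 < 1 / ((n : ℝ) + 2) := by positivity
        constructor <;> simp only [htn] <;> linarith
      have htn_lim : Tendsto tn atTop (𝓝 T) := by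
        have h1 : Tendsto (fun n : ℕ => 1 / ((n : ℝ) + 2)) atTop (𝓝 0) := by
          have := tendsto_one_div_add_atTop_nhds_zero_nat (𝕜 := ℝ)
          have h2 : Tendsto (fun n : ℕ => 1 / (((n + 1 : ℕ) : ℝ) + 1)) atTop (𝓝 0) :=
            this.comp (tendsto_add_atTop_nat 1)
          refine h2.congr fun n => ?_
          push_cast
          ring
        have := h1.const_sub T
        rwa [sub_zero] at this
      -- pointwise convergence of the slices
      have hcont : ∀ y, Tendsto (fun n => ‖u (tn n) y‖ₑ ^ 2) atTop (𝓝 (‖u T y‖ₑ ^ 2)) := by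
        intro y
        have hu : ContinuousWithinAt (fun s => u s y) (Icc 0 T) T := by
          have h1 : ContinuousOn (uncurry u) (Icc 0 T ×ˢ univ) := hcl0.smooth_velocity.continuousOn
          have h2 : ContinuousWithinAt (uncurry u) (Icc 0 T ×ˢ univ) (T, y) :=
            h1 (T, y) ⟨⟨by linarith, le_rfl⟩, mem_univ _⟩
          have h5 : ContinuousWithinAt (fun s : ℝ => ((s, y) : ℝ × EuclideanSpace ℝ (Fin 3)))
              (Icc 0 T) T := continuousWithinAt_id.prodMk continuousWithinAt_const
          exact ContinuousWithinAt.comp (f := fun s : ℝ => ((s, y) : ℝ × EuclideanSpace ℝ (Fin 3)))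
            (x := T) h2 h5 fun s hs => ⟨hs, mem_univ _⟩
        have h3 : Tendsto tn atTop (𝓝[Icc 0 T] T) :=
          tendsto_nhdsWithin_iff.2 ⟨htn_lim, Eventually.of_forall fun n =>
            ⟨by linarith [(htn_mem n).1], (htn_mem n).2.le⟩⟩
        have h4 : Tendsto (fun n => u (tn n) y) atTop (𝓝 (u T y)) := hu.tendsto.comp h3
        exact (ENNReal.continuous_pow 2 |>.tendsto _).comp ((continuous_enorm.tendsto _).comp h4)
      have hmeas : ∀ n, AEMeasurable (fun y => ‖u (tn n) y‖ₑ ^ 2) (volume.restrict (ball x 1)) :=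
        fun n => ((hcl.contDiff_velocity (by
          exact ⟨by linarith [(htn_mem n).1], (htn_mem n).2⟩)).continuous.aemeasurable.enorm.pow_const
            _).restrict
      rw [h']
      calc ∫⁻ y in ball x 1, ‖u T y‖ₑ ^ 2
          = ∫⁻ y in ball x 1, liminf (fun n => ‖u (tn n) y‖ₑ ^ 2) atTop :=
            lintegral_congr fun y => ((hcont y).liminf_eq).symm
        _ ≤ liminf (fun n => ∫⁻ y in ball x 1, ‖u (tn n) y‖ₑ ^ 2) atTop := lintegral_liminf_le' hmeas
        _ ≤ ENNReal.ofReal (B M) :=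
            liminf_le_of_le (h := fun b hb => by
              obtain ⟨n, hn⟩ := hb.exists
              exact hn.trans (hinterior (tn n) (htn_mem n) x))
        _ ≤ _ := hBle
    · exact (hinterior t ⟨h, h'⟩ x).trans hBle
  · -- ### clause E
    set δ : ℕ → ℝ := fun n => 1 / ((n : ℝ) + 3) with hδ
    have hδpos : ∀ n, 0 < δ n := fun n => by simp only [hδ]; positivity
    have hδle : ∀ n, δ n ≤ 1 / 3 := fun n => by
      simp only [hδ]
      exact one_div_le_one_div_of_le (by norm_num) (by linarith [n.cast_nonneg (α := ℝ)])
    have hδanti : ∀ m n : ℕ, m ≤ n → δ n ≤ δ m := fun m n hmn => by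
      simp only [hδ]
      exact one_div_le_one_div_of_le (by positivity) (by exact_mod_cast Nat.add_le_add_right hmn 3)
    set s : ℕ → Set ℝ := fun n => Icc (T - 1 + δ n) (T - δ n) with hs
    have hmono : Monotone s := fun m n hmn => Icc_subset_Icc (by linarith [hδanti m n hmn])
      (by linarith [hδanti m n hmn])
    have hUnion : (⋃ n, s n) = Ioo (T - 1) T := by
      ext t
      simp only [mem_iUnion, hs, mem_Icc, mem_Ioo]
      constructor
      · rintro ⟨n, h1, h2⟩
        exact ⟨by linarith [hδpos n], by linarith [hδpos n]⟩
      · rintro ⟨h1, h2⟩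
        obtain ⟨n, hn⟩ := exists_nat_gt (1 / min (t - (T - 1)) (T - t))
        have hmin : 0 < min (t - (T - 1)) (T - t) := lt_min (by linarith) (by linarith)
        have hδn : δ n < min (t - (T - 1)) (T - t) := by
          simp only [hδ]
          rw [div_lt_iff₀ (by positivity)]
          have := (div_lt_iff₀ hmin).1 hn
          nlinarith
        exact ⟨n, by linarith [min_le_left (t - (T - 1)) (T - t)],
          by linarith [min_le_right (t - (T - 1)) (T - t)]⟩
    have hwin : ∀ n, ∫⁻ t in s n, ∫⁻ y in ball x 1, ENNReal.ofReal (‖fderiv ℝ (u t) y‖ ^ 2) ≤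
        ENNReal.ofReal (B M) := by
      intro n
      have h1 : 0 < T - 1 + δ n := by linarith [hδpos n]
      have h2 : T - 1 ≤ T - 1 + δ n := by linarith [hδpos n]
      have h3 : T - 1 + δ n ≤ T - 1 / 2 := by linarith [hδle n]
      have h4 : T - 1 + δ n ≤ T - δ n := by linarith [hδle n]
      have h5 : T - δ n < T := by linarith [hδpos n]
      have hI : Icc (T - 1 + δ n) (T - δ n) ⊆ Ioo 0 T := fun t ht =>
        ⟨lt_of_lt_of_le h1 ht.1, lt_of_le_of_lt ht.2 h5⟩
      exact (lintegral_window_grad_le hcl h4 hI x).trans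
        (ENNReal.ofReal_le_ofReal (hW hcl0 hEx hτ hrate h1 h2 h3 h4 h5 x).2)
    have hsup := setLIntegral_iUnion_of_directed (μ := volume)
      (fun t => ∫⁻ y in ball x 1, ENNReal.ofReal (‖fderiv ℝ (u t) y‖ ^ 2)) hmono.directed_le
    rw [hUnion] at hsup
    calc ∫⁻ t in Icc (T - 1) T, ∫⁻ y in ball x 1, ENNReal.ofReal (‖fderiv ℝ (u t) y‖ ^ 2)
        = ∫⁻ t in Ioo (T - 1) T, ∫⁻ y in ball x 1, ENNReal.ofReal (‖fderiv ℝ (u t) y‖ ^ 2) :=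
          setLIntegral_congr Ioo_ae_eq_Icc.symm
      _ ≤ ENNReal.ofReal (B M) := by rw [hsup]; exact iSup_le hwin
      _ ≤ _ := hBle

end Summit.NavierStokesRegularity.NavierStokesRegularity.Theorems.ThinCascade

end
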